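import Mathlib
import Summits.Ventures.PercRepro2.Defs
import Summits.Ventures.PercRepro2.CoinDefs
import Summits.Ventures.PercRepro2.CoinArcsOff
import Summits.Ventures.PercRepro2.CoinPendantDefs
import Summits.Ventures.PercRepro2.CoinInduced

/-!
# Contracting the target set to a single vertex (blind cell PercRepro2, night-2 g3;
proofs/NIGHT2-DARC.md §18)

The T-frame theorems (`trace_bhk` and everything built on it) are single-target.  For a target
SET `T ∋ t₀`, CONTRACT `T` to `t₀`: `contract arcs T t₀` renames every arc end lying in `T` to
`t₀` (same coins, same weights).  For a root `s ∉ T`: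
* `R_T = {s ↛ T}` in `arcs` is `{s ↛ t₀}` in the contraction (`avoidEvent_contract`);
* `{v ∈ K⁻_T}` is `{v ⇝ t₀}` for `v ∉ T` (`bwdEvent_contract`);
* on `R_T`, reachability between vertices outside `T` is unchanged (`reach_contract_iff_of_avoid`);
* the gate event of an arc `u → w` (`u, w ∉ T`) is unchanged (`gateEvent_contract`);
* `SameEnds`, `ClosedOut`, `TailCoinsIn`, `tailCoins` and `arcsOff` transport (`P ∩ T = ∅`).
Hence every single-target gate theorem transfers to target sets (`CoinContractDarc.lean`).
-/

namespace Summit.Ventures.PercRepro2.Coin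

section Contract

variable {V : Type*} {E : Type*} [DecidableEq V]

/-- Rename the vertices of `T` to `t₀`. -/
def rename (T : Finset V) (t₀ : V) (x : V) : V := if x ∈ T then t₀ else x

/-- The coin system with `T` contracted to `t₀`. -/
def contract (arcs : E → Finset (V × V)) (T : Finset V) (t₀ : V) : E → Finset (V × V) :=
  fun e => (arcs e).image (fun xy => (rename T t₀ xy.1, rename T t₀ xy.2))

variable {T : Finset V} {t₀ : V}

/-- `rename` fixes the vertices outside `T`. -/
lemma rename_of_notMem {x : V} (hx : x ∉ T) : rename T t₀ x = x := by
  unfold rename; rw [if_neg hx]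

/-- `rename` sends `T` to `t₀`. -/
lemma rename_of_mem {x : V} (hx : x ∈ T) : rename T t₀ x = t₀ := by
  unfold rename; rw [if_pos hx]

/-- `rename` preserves membership in `T` (`t₀ ∈ T`). -/
lemma rename_mem_iff (ht₀ : t₀ ∈ T) (x : V) : rename T t₀ x ∈ T ↔ x ∈ T := by
  unfold rename
  split_ifs with h
  · exact ⟨fun _ => h, fun _ => ht₀⟩
  · exact ⟨fun h' => absurd h' h, fun h' => absurd h' h⟩

/-- A renamed vertex outside `T` is the vertex itself. -/
lemma eq_of_rename_eq_of_notMem (ht₀ : t₀ ∈ T) {x y : V} (hy : y ∉ T) (h : rename T t₀ x = y) :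
    x = y := by
  by_cases hx : x ∈ T
  · rw [rename_of_mem hx] at h; exact absurd (h ▸ ht₀) hy
  · rwa [rename_of_notMem hx] at h

/-- Open arcs are renamed. -/
lemma openArc_contract_of_openArc {arcs : E → Finset (V × V)} {ω : Config E} {x y : V}
    (h : OpenArc arcs ω x y) : OpenArc (contract arcs T t₀) ω (rename T t₀ x) (rename T t₀ y) := by
  obtain ⟨e, he, hxy⟩ := h
  exact ⟨e, he, Finset.mem_image.mpr ⟨(x, y), hxy, rfl⟩⟩

/-- Paths are renamed. -/
lemma reach_contract_of_reach {arcs : E → Finset (V × V)} {ω : Config E} {x y : V}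
    (h : Reach arcs ω x y) : Reach (contract arcs T t₀) ω (rename T t₀ x) (rename T t₀ y) := by
  induction h with
  | refl => exact reach_refl _ _ _
  | tail _ hstep ih => exact Relation.ReflTransGen.tail ih (openArc_contract_of_openArc hstep)

/-- An open arc of the contraction comes from an open arc. -/
lemma openArc_of_openArc_contract {arcs : E → Finset (V × V)} {ω : Config E} {x' y' : V}
    (h : OpenArc (contract arcs T t₀) ω x' y') :
    ∃ x y, rename T t₀ x = x' ∧ rename T t₀ y = y' ∧ OpenArc arcs ω x y := by
  obtain ⟨e, he, hxy⟩ := h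
  obtain ⟨⟨x, y⟩, hmem, hxy'⟩ := Finset.mem_image.mp hxy
  simp only [Prod.mk.injEq] at hxy'
  exact ⟨x, y, hxy'.1, hxy'.2, e, he, hmem⟩

/-- **Paths of the contraction from outside `T`**: either the path avoids `T` and exists in the
original system, or the original system has a path into `T`. -/
lemma reach_of_reach_contract (ht₀ : t₀ ∈ T) {arcs : E → Finset (V × V)} {ω : Config E}
    {x y : V} (hx : x ∉ T) (h : Reach (contract arcs T t₀) ω x y) :
    (y ∉ T ∧ Reach arcs ω x y) ∨ ∃ t ∈ T, Reach arcs ω x t := by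
  induction h with
  | refl => exact Or.inl ⟨hx, reach_refl _ _ _⟩
  | @tail y' z _ hstep ih =>
    rcases ih with ⟨hy', hxy'⟩ | h
    · obtain ⟨y₀, z₀, hy₀, hz₀, harc⟩ := openArc_of_openArc_contract hstep
      have hy₀e : y₀ = y' := eq_of_rename_eq_of_notMem ht₀ hy' hy₀
      subst hy₀e
      by_cases hz₀T : z₀ ∈ T
      · exact Or.inr ⟨z₀, hz₀T, reach_trans hxy' (reach_of_openArc harc)⟩
      · rw [rename_of_notMem hz₀T] at hz₀
        subst hz₀
        exact Or.inl ⟨hz₀T, reach_trans hxy' (reach_of_openArc harc)⟩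
    · exact Or.inr h

/-- `{s ⇝ T}` is `{s ⇝ t₀}` in the contraction, for `s ∉ T`. -/
lemma reach_contract_target_iff (ht₀ : t₀ ∈ T) {arcs : E → Finset (V × V)} {ω : Config E}
    {s : V} (hs : s ∉ T) :
    Reach (contract arcs T t₀) ω s t₀ ↔ ∃ t ∈ T, Reach arcs ω s t := by
  constructor
  · intro h
    rcases reach_of_reach_contract ht₀ hs h with ⟨h', _⟩ | h
    · exact absurd ht₀ h'
    · exact h
  · rintro ⟨t, ht, hst⟩
    have := reach_contract_of_reach (T := T) (t₀ := t₀) hst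
    rwa [rename_of_notMem hs, rename_of_mem ht] at this

/-- `R_T` is the avoidance event of `t₀` in the contraction. -/
theorem avoidEvent_contract (ht₀ : t₀ ∈ T) {arcs : E → Finset (V × V)} {s : V} (hs : s ∉ T) :
    avoidEvent arcs s T = avoidEvent (contract arcs T t₀) s {t₀} := by
  ext ω
  simp only [avoidEvent, Set.mem_setOf_eq, Finset.mem_singleton, forall_eq]
  rw [reach_contract_target_iff ht₀ hs]
  simp only [not_exists, not_and]

/-- `{v ∈ K⁻_T}` is `{v ⇝ t₀}` in the contraction, for `v ∉ T`. -/
theorem bwdEvent_contract (ht₀ : t₀ ∈ T) {arcs : E → Finset (V × V)} {v : V} (hv : v ∉ T) :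
    bwdEvent arcs v T = bwdEvent (contract arcs T t₀) v {t₀} := by
  ext ω
  simp only [bwdEvent, Set.mem_setOf_eq, Finset.mem_singleton, exists_eq_left]
  exact (reach_contract_target_iff ht₀ hv).symm

/-- On `R_T`, reachability between vertices outside `T` is that of the contraction. -/
theorem reach_contract_iff_of_avoid (ht₀ : t₀ ∈ T) {arcs : E → Finset (V × V)} {ω : Config E}
    {s : V} (hs : s ∉ T) (hR : ω ∈ avoidEvent arcs s T) {a : V} (ha : a ∉ T) :
    Reach arcs ω s a ↔ Reach (contract arcs T t₀) ω s a := by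
  constructor
  · intro h
    have := reach_contract_of_reach (T := T) (t₀ := t₀) h
    rwa [rename_of_notMem hs, rename_of_notMem ha] at this
  · intro h
    rcases reach_of_reach_contract ht₀ hs h with ⟨_, h'⟩ | ⟨t, ht, hst⟩
    · exact h'
    · exact absurd hst (hR t ht)

/-- The gate event of `u → w` (`s, u, w ∉ T`) is unchanged by the contraction. -/
theorem gateEvent_contract (ht₀ : t₀ ∈ T) {arcs : E → Finset (V × V)} {s u w : V} (hs : s ∉ T)
    (hu : u ∉ T) (hw : w ∉ T) :
    gateEvent arcs s T u w = gateEvent (contract arcs T t₀) s {t₀} u w := by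
  rw [gateEvent_eq_union, gateEvent_eq_union, ← avoidEvent_contract ht₀ hs,
    ← bwdEvent_contract ht₀ hw]
  ext ω
  simp only [Set.mem_inter_iff, Set.mem_union, Set.mem_compl_iff, fwdEvent, Set.mem_setOf_eq]
  constructor
  · rintro ⟨hR, h⟩
    refine ⟨hR, ?_⟩
    rcases h with h | h
    · exact Or.inl fun h' => h ((reach_contract_iff_of_avoid ht₀ hs hR hu).mpr h')
    · exact Or.inr h
  · rintro ⟨hR, h⟩
    refine ⟨hR, ?_⟩
    rcases h with h | h
    · exact Or.inl fun h' => h ((reach_contract_iff_of_avoid ht₀ hs hR hu).mp h')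
    · exact Or.inr h

/-- `SameEnds` is preserved by the contraction. -/
lemma sameEnds_contract {arcs : E → Finset (V × V)} (hS : SameEnds arcs) :
    SameEnds (contract arcs T t₀) := by
  intro e xy hxy x'y' hx'y'
  obtain ⟨⟨x, y⟩, hmem, rfl⟩ := Finset.mem_image.mp hxy
  obtain ⟨⟨x', y'⟩, hmem', rfl⟩ := Finset.mem_image.mp hx'y'
  obtain ⟨h1, h2⟩ := hS e (x, y) hmem (x', y') hmem'
  simp only at h1 h2 ⊢
  constructor
  · rcases h1 with h | h <;> simp [h]
  · rcases h2 with h | h <;> simp [h]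

/-- Coins with a tail in `P` (`P ∩ T = ∅`) are the same in the contraction. -/
lemma tailCoins_contract (ht₀ : t₀ ∈ T) {arcs : E → Finset (V × V)} {P : Finset V}
    (hPT : Disjoint P T) : tailCoins (contract arcs T t₀) P = tailCoins arcs P := by
  ext e
  simp only [tailCoins, Set.mem_setOf_eq, contract, Finset.mem_image]
  constructor
  · rintro ⟨x'y', ⟨⟨x, y⟩, hmem, rfl⟩, hx⟩
    simp only at hx
    have hxT : x ∉ T := fun h => by
      rw [rename_of_mem h] at hx
      exact Finset.disjoint_left.mp hPT hx ht₀
    rw [rename_of_notMem hxT] at hx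
    exact ⟨(x, y), hmem, hx⟩
  · rintro ⟨⟨x, y⟩, hmem, hx⟩
    have hxT : x ∉ T := fun h => Finset.disjoint_left.mp hPT hx h
    exact ⟨_, ⟨(x, y), hmem, rfl⟩, by simpa [rename_of_notMem hxT] using hx⟩

/-- `ClosedOut` transports: a pendant set closed out into `T` is closed out into `{t₀}`. -/
lemma closedOut_contract (ht₀ : t₀ ∈ T) {arcs : E → Finset (V × V)} {P : Finset V}
    (hPT : Disjoint P T) (h : ClosedOut arcs P T) : ClosedOut (contract arcs T t₀) P {t₀} := by
  intro e x'y' hx'y' hx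
  obtain ⟨⟨x, y⟩, hmem, rfl⟩ := Finset.mem_image.mp hx'y'
  simp only at hx ⊢
  have hxT : x ∉ T := fun hT' => by
    rw [rename_of_mem hT'] at hx
    exact Finset.disjoint_left.mp hPT hx ht₀
  rw [rename_of_notMem hxT] at hx
  rcases Finset.mem_union.mp (h e (x, y) hmem hx) with hy | hy
  · have hyT : y ∉ T := fun h' => Finset.disjoint_left.mp hPT hy h'
    rw [rename_of_notMem hyT]
    exact Finset.mem_union_left _ hy
  · rw [rename_of_mem hy]
    exact Finset.mem_union_right _ (Finset.mem_singleton_self _)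

/-- `TailCoinsIn` transports. -/
lemma tailCoinsIn_contract (ht₀ : t₀ ∈ T) {arcs : E → Finset (V × V)} {P : Finset V}
    (hPT : Disjoint P T) (h : TailCoinsIn arcs P T) :
    TailCoinsIn (contract arcs T t₀) P {t₀} := by
  intro e he x'y' hx'y'
  rw [tailCoins_contract ht₀ hPT] at he
  obtain ⟨⟨x, y⟩, hmem, rfl⟩ := Finset.mem_image.mp hx'y'
  simp only
  rcases Finset.mem_union.mp (h e he (x, y) hmem) with hx | hx
  · have hxT : x ∉ T := fun h' => Finset.disjoint_left.mp hPT hx h'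
    rw [rename_of_notMem hxT]
    exact Finset.mem_union_left _ hx
  · rw [rename_of_mem hx]
    exact Finset.mem_union_right _ (Finset.mem_singleton_self _)

/-- Deleting the arcs with tails in `P ∪ T` commutes with the contraction:
`arcsOff (contract arcs T t₀) (P ∪ {t₀}) = contract (arcsOff arcs (P ∪ T)) T t₀`. -/
lemma arcsOff_contract (ht₀ : t₀ ∈ T) {arcs : E → Finset (V × V)} (P : Finset V) :
    arcsOff (contract arcs T t₀) (P ∪ {t₀}) = contract (arcsOff arcs (P ∪ T)) T t₀ := by
  funext e
  simp only [arcsOff, contract, Finset.filter_image]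
  congr 1
  refine Finset.filter_congr fun ⟨x, y⟩ _ => ?_
  simp only [Finset.mem_union, Finset.mem_singleton, not_or]
  by_cases hxT : x ∈ T
  · rw [rename_of_mem hxT]
    simp only [not_true_eq_false, and_false, false_iff, not_and, not_not]
    intro _; exact hxT
  · rw [rename_of_notMem hxT]
    have hxt₀ : x ≠ t₀ := fun h => hxT (h ▸ ht₀)
    simp only [hxt₀, not_false_eq_true, and_true, hxT]

end Contract

end Summit.Ventures.PercRepro2.Coin
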